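import Mathlib
import Summits.ValiantsHypothesis.ValiantsHypothesis.Theorems.DivisionGapPerMultiplesHardRichPieceExtremal
import Summits.ValiantsHypothesis.ValiantsHypothesis.Theorems.DivisionGapPerMultiplesHardStubMatchingGlue
import Summits.ValiantsHypothesis.ValiantsHypothesis.Theorems.DivisionGapPerMultiplesHardStubMatchingCount

/-!
# `DivisionGap.PerMultiplesHard` (stmt-ValiantsHypothesis-5068), line `uncharged-face-walk`:
the RICH PIECE, part 3 — `stub_richPiece` (lead c9, cycle 9)

Every RICH host `G ⊆ [n]²` (`n! ≤ Kⁿ·#PM(G)`) contains a σ₀-square sub-board `R × C` (`σ₀ ⊆ G` a perfect matching with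
`σ₀(C) = R`) of linear size `#R = #C = nn ≥ n/K^{32K}` with minimum degrees `nn/(4K)` and Hall surplus `nn/(2048K²) + 1`:
the abstract `extremal_piece` (part 2) instantiated with the admissible family {`(R,C)`: `#R = #C ≥ 1`, σ-square for some
perfect matching of `G`} and the intrinsic matching count of `stub_matchingCount` (functions `Fin n → Fin n` mapping `C`
injectively into `R` along `G` and fixing `Cᶜ`); closure under the moves is the three-piece gluing `stub_matchingGlue` (ii).
This is the structural half of the extraction `stub_quasiRandomSquareBlock` of the skeleton
`Cruxes/PerMultiplesHard/Lines/uncharged_face_walk.lean`. Elementary. [folklore]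
-/

noncomputable section

-- `Summit.ValiantsHypothesis.ValiantsHypothesis.…` is the tree's mandated layout (Sub = Summit).
set_option linter.dupNamespace false

open Finset
open scoped BigOperators

namespace Summit.ValiantsHypothesis.ValiantsHypothesis.Theorems.DivisionGap.PerMultiplesHard.RichPiece

/-! ### The rich piece of a rich host -/

/-- **stub_richPiece — the extremal σ₀-square sub-board of a rich host (lead c9; the structural half of the extraction
`stub_quasiRandomSquareBlock`).**  For every `K ≥ 1` there are `CA = K^{32K}`, `n₀` such that every RICH host `G ⊆ [n]²`
(`n! ≤ Kⁿ·#PM(G)`, `n ≥ n₀`) contains a sub-board `R × C`, `#R = #C = nn ≥ n/CA`, which is σ₀-SQUARE for a perfect matching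
`σ₀ ⊆ G` (`σ₀(C) = R`), has MINIMUM DEGREES `nn/(4K)` (rows into `C`, columns into `R`) and HALL SURPLUS `s = nn/(2048K²) + 1`:
every nonempty row set `U ⊆ R` with `#U + s ≤ nn` sees at least `#U + s` columns of `C`.  PROOF: `extremal_piece` applied to the
admissible family {`(R, C)` : `#R = #C ≥ 1`, σ-square for some perfect matching `σ ⊆ G`} with the intrinsic matching count of
`stub_matchingCount` (functions mapping `C` injectively into `R` along `G` and fixing `Cᶜ`); closure under removal and splitting is
the three-piece gluing `stub_matchingGlue` (ii). [folklore] -/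
theorem stub_richPiece :
    ∀ K : ℕ, 1 ≤ K → ∃ CA n₀ : ℕ, 1 ≤ CA ∧ ∀ n ≥ n₀, ∀ G : Finset (Fin n × Fin n),
      n.factorial ≤ K ^ n * ((Finset.univ : Finset (Equiv.Perm (Fin n))).filter (fun σ => ∀ i, (σ i, i) ∈ G)).card →
      ∃ (nn s : ℕ) (R C : Finset (Fin n)) (σ₀ : Equiv.Perm (Fin n)),
        R.card = nn ∧ C.card = nn ∧ n ≤ CA * nn ∧ nn ≤ 2048 * K ^ 2 * s ∧ s < nn ∧
        (∀ i, (σ₀ i, i) ∈ G) ∧ (∀ i, σ₀ i ∈ R ↔ i ∈ C) ∧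
        (∀ x ∈ R, nn ≤ 4 * K * (C.filter fun j => (x, j) ∈ G).card) ∧
        (∀ y ∈ C, nn ≤ 4 * K * (R.filter fun i => (i, y) ∈ G).card) ∧
        (∀ U ⊆ R, U.Nonempty → U.card + s ≤ nn →
          U.card + s ≤ (C.filter fun j => ∃ r ∈ U, (r, j) ∈ G).card) := by
  intro K hK
  refine ⟨K ^ (32 * K), 2 * K ^ (32 * K), Nat.one_le_pow _ _ hK, ?_⟩
  intro n hn G hrich
  classical
  -- the matchings of a sub-board, as functions fixing the outside columns
  let Mset : Finset (Fin n) → Finset (Fin n) → Finset (Fin n → Fin n) := fun R C =>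
    (Finset.univ : Finset (Fin n → Fin n)).filter fun f =>
      (∀ j ∈ C, f j ∈ R ∧ (f j, j) ∈ G) ∧ (∀ j, j ∉ C → f j = j) ∧ (∀ j ∈ C, ∀ j' ∈ C, f j = f j' → j = j')
  let M : Finset (Fin n) → Finset (Fin n) → ℕ := fun R C => (Mset R C).card
  let adm : Finset (Finset (Fin n) × Finset (Fin n)) := Finset.univ.filter fun p =>
    p.1.card = p.2.card ∧ 1 ≤ p.2.card ∧
      ∃ σ : Equiv.Perm (Fin n), (∀ i, (σ i, i) ∈ G) ∧ (∀ i, σ i ∈ p.1 ↔ i ∈ p.2)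
  have memM : ∀ (R C : Finset (Fin n)) (f : Fin n → Fin n), f ∈ Mset R C ↔
      (∀ j ∈ C, f j ∈ R ∧ (f j, j) ∈ G) ∧ (∀ j, j ∉ C → f j = j) ∧ (∀ j ∈ C, ∀ j' ∈ C, f j = f j' → j = j') := by
    intro R C f
    simp only [Mset, Finset.mem_filter, Finset.mem_univ, true_and]
  have memA : ∀ p : Finset (Fin n) × Finset (Fin n), p ∈ adm ↔
      p.1.card = p.2.card ∧ 1 ≤ p.2.card ∧
        ∃ σ : Equiv.Perm (Fin n), (∀ i, (σ i, i) ∈ G) ∧ (∀ i, σ i ∈ p.1 ↔ i ∈ p.2) := by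
    intro p
    simp only [adm, Finset.mem_filter, Finset.mem_univ, true_and]
  obtain ⟨hA, hB, hC, hD, hE⟩ := MatchingCount.stub_matchingCount
  obtain ⟨-, hglue⟩ := MatchingGlue.stub_matchingGlue
  -- (L1) admissible pieces have at least one matching
  have hM1 : ∀ p ∈ adm, 1 ≤ M p.1 p.2 := by
    intro p hp
    obtain ⟨-, -, σ, hσG, hσsq⟩ := (memA p).mp hp
    apply Finset.card_pos.mpr
    refine ⟨fun j => if j ∈ p.2 then σ j else j, (memM _ _ _).mpr ⟨?_, ?_, ?_⟩⟩
    · intro j hj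
      simp only [hj, if_true]
      exact ⟨(hσsq j).mpr hj, hσG j⟩
    · intro j hj
      simp only [hj, if_false]
    · intro j hj j' hj' h
      simp only [hj, hj', if_true] at h
      exact σ.injective h
  -- from `1 ≤ M R C` extract a matching function
  have getM : ∀ R C : Finset (Fin n), 1 ≤ M R C → ∃ f : Fin n → Fin n,
      (∀ j ∈ C, f j ∈ R ∧ (f j, j) ∈ G) ∧ (∀ j, j ∉ C → f j = j) ∧ (∀ j ∈ C, ∀ j' ∈ C, f j = f j' → j = j') := by
    intro R C h
    obtain ⟨f, hf⟩ := Finset.card_pos.mp h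
    exact ⟨f, (memM R C f).mp hf⟩
  -- (h0) the full board is admissible
  have hpm1 : 1 ≤ ((Finset.univ : Finset (Equiv.Perm (Fin n))).filter (fun σ => ∀ i, (σ i, i) ∈ G)).card := by
    by_contra h
    push Not at h
    have h0 : ((Finset.univ : Finset (Equiv.Perm (Fin n))).filter (fun σ => ∀ i, (σ i, i) ∈ G)).card = 0 := by omega
    rw [h0, mul_zero] at hrich
    exact absurd hrich (by have := Nat.factorial_pos n; omega)
  have hKpow : 1 ≤ K ^ (32 * K) := Nat.one_le_pow _ _ hK
  have hn1 : 1 ≤ n := by omega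
  have h0 : ((Finset.univ : Finset (Fin n)), (Finset.univ : Finset (Fin n))) ∈ adm := by
    obtain ⟨σ, hσ⟩ := Finset.card_pos.mp hpm1
    rw [Finset.mem_filter] at hσ
    refine (memA _).mpr ⟨rfl, by simpa using hn1, σ, hσ.2, fun i => by simp⟩
  -- gluing: a matching of (U,S) and one of (R∖U, C∖S) inside a σ-square (R,C) give a σ'-square structure
  have glue : ∀ (R C U S : Finset (Fin n)), (∃ σ : Equiv.Perm (Fin n), (∀ i, (σ i, i) ∈ G) ∧ (∀ i, σ i ∈ R ↔ i ∈ C)) →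
      U ⊆ R → S ⊆ C → U.card = S.card → 1 ≤ M U S → 1 ≤ M (R \ U) (C \ S) →
      ∃ σ : Equiv.Perm (Fin n), (∀ i, (σ i, i) ∈ G) ∧ (∀ i, σ i ∈ U ↔ i ∈ S) ∧ (∀ i, σ i ∈ R ↔ i ∈ C) := by
    intro R C U S ⟨σ, hσG, hσsq⟩ hU hS hUS h1 h2
    obtain ⟨f₁, hf₁a, -, hf₁c⟩ := getM U S h1
    obtain ⟨f₂, hf₂a, -, hf₂c⟩ := getM (R \ U) (C \ S) h2
    exact hglue n G R C U S σ f₁ f₂ hσG hσsq hU hS hUS hf₁a hf₁c hf₂a hf₂c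
  -- removal of a matched cell (x, y): admissibility of (R.erase x, C.erase y)
  have hremove : ∀ p ∈ adm, ∀ x ∈ p.1, ∀ y ∈ p.2, (x, y) ∈ G → 2 ≤ p.2.card →
      1 ≤ M (p.1.erase x) (p.2.erase y) → (p.1.erase x, p.2.erase y) ∈ adm := by
    intro p hp x hx y hy hxy hc2 hM'
    obtain ⟨hcard, -, hσ⟩ := (memA p).mp hp
    have hUS : (p.1.erase x).card = (p.2.erase y).card := by
      rw [Finset.card_erase_of_mem hx, Finset.card_erase_of_mem hy, hcard]
    -- the complementary single cell
    have h2 : 1 ≤ M (p.1 \ p.1.erase x) (p.2 \ p.2.erase y) := by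
      apply Finset.card_pos.mpr
      refine ⟨fun j => if j = y then x else j, (memM _ _ _).mpr ⟨?_, ?_, ?_⟩⟩
      · intro j hj
        have hjy : j = y := by
          rw [Finset.mem_sdiff, Finset.mem_erase] at hj; tauto
        subst hjy
        simp only [if_true]
        refine ⟨?_, hxy⟩
        rw [Finset.mem_sdiff, Finset.mem_erase]
        exact ⟨hx, fun h => h.1 rfl⟩
      · intro j hj
        have hjy : j ≠ y := by
          intro h; apply hj; subst h
          rw [Finset.mem_sdiff, Finset.mem_erase]
          exact ⟨hy, fun h => h.1 rfl⟩
        simp only [hjy, if_false]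
      · intro j hj j' hj' _
        have hjy : j = y := by
          rw [Finset.mem_sdiff, Finset.mem_erase] at hj; tauto
        have hjy' : j' = y := by
          rw [Finset.mem_sdiff, Finset.mem_erase] at hj'; tauto
        rw [hjy, hjy']
    obtain ⟨σ', hσ'G, hσ'sq, -⟩ := glue p.1 p.2 (p.1.erase x) (p.2.erase y) hσ (Finset.erase_subset _ _)
      (Finset.erase_subset _ _) hUS hM' h2
    refine (memA _).mpr ⟨hUS, ?_, σ', hσ'G, hσ'sq⟩
    show 1 ≤ (p.2.erase y).card
    rw [Finset.card_erase_of_mem hy]; omega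
  -- the hypotheses of the abstract lemma
  have hcard : ∀ p ∈ adm, p.1.card = p.2.card := fun p hp => ((memA p).mp hp).1
  have hpos : ∀ p ∈ adm, 1 ≤ p.2.card := fun p hp => ((memA p).mp hp).2.1
  have hMfac : ∀ p ∈ adm, M p.1 p.2 ≤ p.2.card.factorial := fun p hp => hE n G p.1 p.2 (hcard p hp)
  have hrichG : n.factorial ≤ K ^ n * M Finset.univ Finset.univ :=
    le_trans hrich (Nat.mul_le_mul_left _ (hA n G))
  have hrow : ∀ p ∈ adm, ∀ x ∈ p.1, 2 ≤ p.2.card → ∃ y ∈ p.2, (p.1.erase x, p.2.erase y) ∈ adm ∧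
      M p.1 p.2 ≤ (p.2.filter fun j => (x, j) ∈ G).card * M (p.1.erase x) (p.2.erase y) := by
    intro p hp x hx hc2
    obtain ⟨y, hy, hxy, hle⟩ := hC n G p.1 p.2 x hx (hcard p hp)
    have hle' : M p.1 p.2 ≤ (p.2.filter fun j => (x, j) ∈ G).card * M (p.1.erase x) (p.2.erase y) := hle
    have hm := hM1 p hp
    have hxy' : (x, y) ∈ G := by
      rcases hxy with h | h
      · exact h
      · exact absurd (show M p.1 p.2 = 0 from h) (by omega)
    have hM' : 1 ≤ M (p.1.erase x) (p.2.erase y) := by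
      by_contra h
      push Not at h
      have h0 : M (p.1.erase x) (p.2.erase y) = 0 := by omega
      rw [h0, mul_zero] at hle'
      omega
    exact ⟨y, hy, hremove p hp x hx y hy hxy' hc2 hM', hle'⟩
  have hcol : ∀ p ∈ adm, ∀ y ∈ p.2, 2 ≤ p.2.card → ∃ x ∈ p.1, (p.1.erase x, p.2.erase y) ∈ adm ∧
      M p.1 p.2 ≤ (p.1.filter fun i => (i, y) ∈ G).card * M (p.1.erase x) (p.2.erase y) := by
    intro p hp y hy hc2
    obtain ⟨x, hx, hxy, hle⟩ := hD n G p.1 p.2 y hy (hcard p hp)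
    have hle' : M p.1 p.2 ≤ (p.1.filter fun i => (i, y) ∈ G).card * M (p.1.erase x) (p.2.erase y) := hle
    have hm := hM1 p hp
    have hxy' : (x, y) ∈ G := by
      rcases hxy with h | h
      · exact h
      · exact absurd (show M p.1 p.2 = 0 from h) (by omega)
    have hM' : 1 ≤ M (p.1.erase x) (p.2.erase y) := by
      by_contra h
      push Not at h
      have h0 : M (p.1.erase x) (p.2.erase y) = 0 := by omega
      rw [h0, mul_zero] at hle'
      omega
    exact ⟨x, hx, hremove p hp x hx y hy hxy' hc2 hM', hle'⟩
  have hsplit : ∀ p ∈ adm, ∀ U ⊆ p.1, U.Nonempty → U.card < p.1.card → ∃ S ⊆ p.2, S.card = U.card ∧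
      (U, S) ∈ adm ∧ (p.1 \ U, p.2 \ S) ∈ adm ∧
      M p.1 p.2 ≤ (p.2.filter fun j => ∃ r ∈ U, (r, j) ∈ G).card.choose U.card * (M U S * M (p.1 \ U) (p.2 \ S)) := by
    intro p hp U hU hUne hUlt
    obtain ⟨S, hS, hScard, hle⟩ := hB n G p.1 p.2 U hU (hcard p hp)
    have hle' : M p.1 p.2 ≤ (p.2.filter fun j => ∃ r ∈ U, (r, j) ∈ G).card.choose U.card *
        (M U S * M (p.1 \ U) (p.2 \ S)) := hle
    have hm := hM1 p hp
    obtain ⟨hc, -, hσ⟩ := (memA p).mp hp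
    have hprod : 1 ≤ M U S * M (p.1 \ U) (p.2 \ S) := by
      by_contra h
      push Not at h
      have h0 : M U S * M (p.1 \ U) (p.2 \ S) = 0 := by omega
      rw [h0, mul_zero] at hle'
      omega
    have h1 : 1 ≤ M U S := by
      rcases Nat.eq_zero_or_pos (M U S) with h0 | h0
      · rw [h0, zero_mul] at hprod; omega
      · exact h0
    have h2 : 1 ≤ M (p.1 \ U) (p.2 \ S) := by
      rcases Nat.eq_zero_or_pos (M (p.1 \ U) (p.2 \ S)) with h0 | h0
      · rw [h0, mul_zero] at hprod; omega
      · exact h0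
    obtain ⟨σ', hσ'G, hσ'US, hσ'RC⟩ := glue p.1 p.2 U S hσ hU hS hScard.symm h1 h2
    refine ⟨S, hS, hScard, ?_, ?_, hle'⟩
    · exact (memA _).mpr ⟨hScard.symm, by rw [hScard]; exact Finset.card_pos.mpr hUne, σ', hσ'G, hσ'US⟩
    · refine (memA _).mpr ⟨?_, ?_, σ', hσ'G, ?_⟩
      · show (p.1 \ U).card = (p.2 \ S).card
        rw [Finset.card_sdiff_of_subset hU, Finset.card_sdiff_of_subset hS, hScard, hc]
      · show 1 ≤ (p.2 \ S).card
        rw [Finset.card_sdiff_of_subset hS, hScard, ← hc]; omega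
      · intro i
        show σ' i ∈ p.1 \ U ↔ i ∈ p.2 \ S
        rw [Finset.mem_sdiff, Finset.mem_sdiff, hσ'RC i, hσ'US i]
  obtain ⟨p, hp, hsize, hc2, hrowdeg, hcoldeg, hsur⟩ :=
    extremal_piece G K adm M hK hn h0 hcard hpos hM1 hMfac hrichG hrow hcol hsplit
  obtain ⟨hc, -, σ₀, hσ₀G, hσ₀sq⟩ := (memA p).mp hp
  refine ⟨p.2.card, p.2.card / (2048 * K ^ 2) + 1, p.1, p.2, σ₀, hc, rfl, hsize, ?_, ?_, hσ₀G, hσ₀sq,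
    hrowdeg, hcoldeg, hsur⟩
  · exact (Nat.lt_mul_div_succ _ (by positivity)).le
  · have : p.2.card / (2048 * K ^ 2) ≤ p.2.card / 2048 :=
      Nat.div_le_div_left (Nat.le_mul_of_pos_right _ (by positivity)) (by norm_num)
    omega

end Summit.ValiantsHypothesis.ValiantsHypothesis.Theorems.DivisionGap.PerMultiplesHard.RichPiece
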